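import Mathlib.FieldTheory.Finite.Basic
import Mathlib.NumberTheory.Padics.RingHoms
import Literature.NumberTheory.EllipticCurves.CofreeContinuousRep
import Literature.NumberTheory.EllipticCurves.BigGaloisRepSelmer
import Literature.NumberTheory.GaloisRepresentations.FramedRepTwist
import HarnessLib

/-!
# Twisting a framed representation by a character congruent to `1` modulo `r` does not change the `r`-torsion
# Galois module of its cofree module

`Proofs` file (theorems only: no definition, no named fact, no instance; D-0026) in topic `NumberTheory/EllipticCurves`
(cell `bsd-stepL`, seat `bsd-stepL-imc-p1` g24; memo `run/shared/lean/pub/bsd-stepL/imc-p1/g24/TWIST-AUDIT-25505-imc-p1-g24.md`,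
repair step (R3)).

For a framed representation `ρ : G → GL_n(𝒪)`, a continuous character `χ : G →ₜ* 𝒪ˣ` and the twist `ρ ⊗ χ`
(`FramedRep.twist`, `g ↦ χ(g)·ρ(g)`), the cofree modules `A(ρ) = Fⁿ/𝒪ⁿ` and `A(ρ ⊗ χ)` are the SAME `𝒪`-module
(`Cofree _ F := (Fin n → F) ⧸ 𝒪ⁿ` does not depend on the representation) with `G`-actions differing by the scalar `χ(g)`
(`cofreeRepresentation_twist_apply`). Hence on every `a` killed by `χ(g) − 1` the two actions of `g` agree
(`cofreeRepresentation_twist_apply_eq_of_sub_one_smul_eq_zero`); in particular, if `r ∣ χ(g) − 1` for all `g`, the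
`r`-torsion subrepresentations `A(ρ ⊗ χ)[r]` and `A(ρ)[r]` (`BigGaloisRep.torsionRep`) are the same `𝒪[G]`-module
(`torsionRep_cofree_twist_apply_coe`), and any `G`-equivariant `𝒪`-isomorphism out of `A(ρ)[r]` is `G`-equivariant out of
`A(ρ ⊗ χ)[r]` (`exists_equivariant_equiv_torsion_twist`). This is the elementary step behind the congruence (b) of Castella's
erratum (proof of Thm. 1.1, p. 4: "a `G_ℚ`-stable lattice `T_{g_m} ⊂ V_{g_m}` [in the self-dual Tate twist] and an isomorphism
`T_{g_m}/p^m T_{g_m} ≃ T/p^m T`") when the member lattice is presented UNTWISTED (Skinner 2016 §2.6, tree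
`Skinner2016.HidaCongruentMember.exists_equivariant_equiv`) and the self-dual twist `ε^{1−k_m/2}` is `≡ 1 (mod p^m)`,
i.e. `(p−1)p^{m−1} ∣ k_m/2 − 1` — supplied here in the form every cyclotomic power needs: for `u ∈ ℤ_pˣ` and
`(p−1)p^{m−1} ∣ j`, `p^m ∣ u^j − 1` (Euler's theorem in `ℤ/p^m`, `padicInt_pow_dvd_units_zpow_sub_one`), pushed to any
`ℤ_p`-algebra (`pow_dvd_units_map_zpow_sub_one`) and to continuous characters `G →ₜ* 𝒪ˣ` of the form `Units.map ∘ ψ`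
(`ContinuousMonoidHom.zpow_apply`).

## References

* [Castella2018Erratum] F. Castella, Erratum to "On the `p`-part of the BSD formula for multiplicative primes", §2 (p. 2: the
  self-dual Tate twist) and proof of Thm. 1.1 (p. 4, (a)(b)). [Skinner2016PacificMC] §2.6 (2-6-1). [BCDTJAMS2001] §2.2 (twists by characters).
-/

noncomputable section

open Field Topology

namespace Literature.NumberTheory.EllipticCurves.GreenbergSelmer

open Literature.NumberTheory.GaloisRepresentations Literature.NumberTheory.EllipticCurves.BigGaloisRep

/-! ### Integer powers of continuous characters -/

section Zpow

variable {A E : Type*} [Monoid A] [TopologicalSpace A] [CommGroup E] [TopologicalSpace E] [IsTopologicalGroup E]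

/-- Values of an integer power of a continuous homomorphism into a commutative topological group:
`(f ^ z) a = (f a) ^ z` (Mathlib has the `ℕ`-power `ContinuousMonoidHom.pow_apply`); used for the integer cyclotomic power
`ε^{1−k/2}` of the self-dual Tate twist. [folklore] [cite: Castella2018Erratum, §2 (p. 2, "the self-dual Tate twist")] -/
theorem ContinuousMonoidHom.zpow_apply (f : A →ₜ* E) (z : ℤ) (a : A) : (f ^ z) a = f a ^ z := by
  obtain ⟨n, rfl | rfl⟩ := z.eq_nat_or_neg
  · rw [zpow_natCast, zpow_natCast, ContinuousMonoidHom.pow_apply]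
  · rw [zpow_neg, zpow_neg, zpow_natCast, zpow_natCast, ← ContinuousMonoidHom.pow_apply]
    rfl

end Zpow

/-! ### Euler's theorem in `ℤ_p` modulo `p^m`, and its transport to `ℤ_p`-algebras -/

section Euler

variable {p : ℕ} [Fact p.Prime]

/-- **Euler in `ℤ_p/p^m`**: for `u ∈ ℤ_pˣ`, `m ≥ 1` and `(p−1)p^{m−1} ∣ j` (`j ∈ ℤ`), `p^m ∣ u^j − 1` in `ℤ_p`
(reduce by `PadicInt.toZModPow m`, whose kernel is `(p^m)`; in `(ℤ/p^m)ˣ` every element has order dividing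
`φ(p^m) = p^{m−1}(p−1)`, Mathlib `ZMod.pow_totient`) — the arithmetic behind the erratum's member weights "`k_m ≡ 2 (mod p − 1)`",
`k_m → 2` `p`-adically. [folklore] [cite: Castella2018Erratum, proof of Thm. 1.1 (p. 4, (a) "`k_m > 2` with `k_m ≡ 2 (mod p − 1)`")] -/
theorem padicInt_pow_dvd_units_zpow_sub_one (u : ℤ_[p]ˣ) {m : ℕ} (hm : 1 ≤ m) {j : ℤ}
    (hj : (((p - 1) * p ^ (m - 1) : ℕ) : ℤ) ∣ j) :
    (p : ℤ_[p]) ^ m ∣ ((u ^ j : ℤ_[p]ˣ) : ℤ_[p]) - 1 := by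
  have hp : p.Prime := Fact.out
  obtain ⟨c, rfl⟩ := hj
  set w : (ZMod (p ^ m))ˣ := Units.map (PadicInt.toZModPow m : ℤ_[p] →+* ZMod (p ^ m)).toMonoidHom u with hw
  have hφ : Nat.totient (p ^ m) = (p - 1) * p ^ (m - 1) := by
    rw [Nat.totient_prime_pow hp (by omega), mul_comm]
  have hw1 : w ^ ((((p - 1) * p ^ (m - 1) : ℕ) : ℤ) * c) = 1 := by
    rw [zpow_mul, zpow_natCast, ← hφ, ZMod.pow_totient, one_zpow]
  have hker : ((u ^ ((((p - 1) * p ^ (m - 1) : ℕ) : ℤ) * c) : ℤ_[p]ˣ) : ℤ_[p]) - 1 ∈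
      RingHom.ker (PadicInt.toZModPow m : ℤ_[p] →+* ZMod (p ^ m)) := by
    rw [RingHom.mem_ker, map_sub, map_one, sub_eq_zero]
    have : (PadicInt.toZModPow m : ℤ_[p] →+* ZMod (p ^ m))
        ((u ^ ((((p - 1) * p ^ (m - 1) : ℕ) : ℤ) * c) : ℤ_[p]ˣ) : ℤ_[p]) =
        ((w ^ ((((p - 1) * p ^ (m - 1) : ℕ) : ℤ) * c) : (ZMod (p ^ m))ˣ) : ZMod (p ^ m)) := by
      rw [hw, ← map_zpow, Units.coe_map]
      rfl
    rw [this, hw1, Units.val_one]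
  rw [PadicInt.ker_toZModPow] at hker
  exact Ideal.mem_span_singleton.1 hker

/-- Transport to a `ℤ_p`-algebra `O`: for `u ∈ ℤ_pˣ`, `m ≥ 1`, `(p−1)p^{m−1} ∣ j`,
`p^m ∣ (algebraMap u)^j − 1` in `O` (the unit `Units.map (algebraMap ℤ_p O) u` raised to `j`). [folklore]
[cite: Castella2018Erratum, proof of Thm. 1.1 (p. 4, (a)(b))] -/
theorem pow_dvd_units_map_zpow_sub_one {O : Type*} [CommRing O] [Algebra ℤ_[p] O] (u : ℤ_[p]ˣ) {m : ℕ}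
    (hm : 1 ≤ m) {j : ℤ} (hj : (((p - 1) * p ^ (m - 1) : ℕ) : ℤ) ∣ j) :
    (p : O) ^ m ∣ (((Units.map (algebraMap ℤ_[p] O : ℤ_[p] →* O) u ^ j : Oˣ) : O)) - 1 := by
  have h := map_dvd (algebraMap ℤ_[p] O) (padicInt_pow_dvd_units_zpow_sub_one u hm hj)
  rw [map_pow, map_natCast, map_sub, map_one] at h
  convert h using 2
  rw [← map_zpow, Units.coe_map]
  rfl

end Euler

/-! ### The cofree module of a twist -/

section Twist

universe u

-- `BigGaloisRep.torsionRep` asks the group and the module to live in one universe; so do we.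
variable {G : Type u} [Group G] [TopologicalSpace G]
variable {n : ℕ} {𝒪 : Type*} [CommRing 𝒪] [TopologicalSpace 𝒪] [IsTopologicalRing 𝒪]
variable (F : Type u) [Field F] [Algebra 𝒪 F]

/-- `ρ ⊗ χ` acts on `Fⁿ` by `χ(g) · ρ(g)`: `fracRepresentation F (ρ.twist χ) g x = χ(g) • fracRepresentation F ρ g x`.
[cite: BCDTJAMS2001, §2.2 (proof of Thm. 2.2.1, p. 860: twisting by a character)] -/
theorem fracRepresentation_twist_apply (ρ : FramedRep G 𝒪 n) (χ : G →ₜ* 𝒪ˣ) (g : G) (x : Fin n → F) :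
    fracRepresentation F (FramedRep.twist ρ χ) g x = ((χ g : 𝒪ˣ) : 𝒪) • fracRepresentation F ρ g x := by
  rw [fracRepresentation_apply_apply, fracRepresentation_apply_apply, FramedRep.coe_twist_apply]
  ext i
  simp only [Matrix.mulVec, dotProduct, Matrix.map_apply, Matrix.smul_apply, smul_eq_mul, map_mul,
    Pi.smul_apply, Finset.smul_sum]
  refine Finset.sum_congr rfl fun j _ ↦ ?_
  rw [Algebra.smul_def, mul_assoc]

/-- **The cofree module of a twist**: on `A = Fⁿ/𝒪ⁿ` (the same `𝒪`-module for `ρ` and `ρ ⊗ χ`), `g` acts through `ρ ⊗ χ` as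
`χ(g)` times its action through `ρ`. [cite: BCDTJAMS2001, §2.2 (p. 860)] [cite: Castella2018Erratum, §2 (p. 2, the self-dual Tate twist of `T_g`)] -/
theorem cofreeRepresentation_twist_apply (ρ : FramedRep G 𝒪 n) (χ : G →ₜ* 𝒪ˣ) (g : G) (a : Cofree ρ F) :
    cofreeRepresentation F (FramedRep.twist ρ χ) g a = ((χ g : 𝒪ˣ) : 𝒪) • cofreeRepresentation F ρ g a := by
  obtain ⟨x, rfl⟩ := cofreeMk_surjective F ρ a
  change cofreeRepresentation F (FramedRep.twist ρ χ) g (cofreeMk F (FramedRep.twist ρ χ) x) = _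
  rw [cofreeRepresentation_cofreeMk, cofreeRepresentation_cofreeMk, fracRepresentation_twist_apply, map_smul]
  rfl

/-- If `(χ(g) − 1) · a = 0` then `g` acts on `a` in the same way through `ρ ⊗ χ` and through `ρ`.
[cite: Castella2018Erratum, proof of Thm. 1.1 (p. 4, (b))] -/
theorem cofreeRepresentation_twist_apply_eq_of_sub_one_smul_eq_zero (ρ : FramedRep G 𝒪 n) (χ : G →ₜ* 𝒪ˣ) (g : G)
    (a : Cofree ρ F) (h : (((χ g : 𝒪ˣ) : 𝒪) - 1) • a = 0) :
    cofreeRepresentation F (FramedRep.twist ρ χ) g a = cofreeRepresentation F ρ g a := by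
  rw [cofreeRepresentation_twist_apply]
  have h' : (((χ g : 𝒪ˣ) : 𝒪) - 1) • cofreeRepresentation F ρ g a = 0 := by
    rw [← map_smul, h, map_zero]
  rwa [sub_smul, one_smul, sub_eq_zero] at h'

/-- On `r`-torsion elements, `r ∣ χ(g) − 1` makes the two actions of `g` agree.
[cite: Castella2018Erratum, proof of Thm. 1.1 (p. 4, (b))] -/
theorem cofreeRepresentation_twist_apply_eq_of_dvd (ρ : FramedRep G 𝒪 n) (χ : G →ₜ* 𝒪ˣ) (g : G) {r : 𝒪}
    (hχ : r ∣ ((χ g : 𝒪ˣ) : 𝒪) - 1) (a : Cofree ρ F) (ha : r • a = 0) :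
    cofreeRepresentation F (FramedRep.twist ρ χ) g a = cofreeRepresentation F ρ g a := by
  refine cofreeRepresentation_twist_apply_eq_of_sub_one_smul_eq_zero F ρ χ g a ?_
  obtain ⟨c, hc⟩ := hχ
  rw [hc, mul_comm, mul_smul, ha, smul_zero]

variable [ContinuousMul G]

/-- **The `r`-torsion Galois modules of `A(ρ ⊗ χ)` and `A(ρ)` coincide when `χ ≡ 1 (mod r)`**: for every `g` and every
`x ∈ A[r]`, `(ρ ⊗ χ)(g) x = ρ(g) x` (tree `BigGaloisRep.torsionRep` of the continuous cofree representation `cofreeContinuousRep`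
of the twist, computed through the UNTWISTED `cofreeRepresentation F ρ`; `A(ρ ⊗ χ)` and `A(ρ)` are the same `𝒪`-module, and so
are their `r`-torsion submodules). [cite: Castella2018Erratum, §2 (p. 2) and proof of Thm. 1.1 (p. 4, (b))] -/
theorem torsionRep_cofree_twist_apply_coe (ρ : FramedRep G 𝒪 n) (χ : G →ₜ* 𝒪ˣ) (hF : HasOpenDenominators 𝒪 F)
    {r : 𝒪} (hχ : ∀ g, r ∣ ((χ g : 𝒪ˣ) : 𝒪) - 1) (g : G)
    (x : Submodule.torsionBy 𝒪 (Cofree (FramedRep.twist ρ χ) F) r) :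
    ((torsionRep (cofreeContinuousRep F (FramedRep.twist ρ χ) hF) r g x :
        Submodule.torsionBy 𝒪 (Cofree (FramedRep.twist ρ χ) F) r) : Cofree (FramedRep.twist ρ χ) F) =
      cofreeRepresentation F ρ g (x : Cofree (FramedRep.twist ρ χ) F) := by
  rw [torsionRep_apply_coe, cofreeContinuousRep_apply, smul_def]
  exact cofreeRepresentation_twist_apply_eq_of_dvd F ρ χ g (hχ g) (x : Cofree (FramedRep.twist ρ χ) F)
    ((Submodule.mem_torsionBy_iff r (x : Cofree (FramedRep.twist ρ χ) F)).1 x.2)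

/-- The same, against the untwisted torsion representation: `(ρ ⊗ χ)(g) x = ρ(g) x` in `A[r]` (the two `r`-torsion
subrepresentations have the same carrier; the equation is between their values on the same element).
[cite: Castella2018Erratum, proof of Thm. 1.1 (p. 4, (b))] -/
theorem torsionRep_cofree_twist_apply (ρ : FramedRep G 𝒪 n) (χ : G →ₜ* 𝒪ˣ) (hF : HasOpenDenominators 𝒪 F)
    {r : 𝒪} (hχ : ∀ g, r ∣ ((χ g : 𝒪ˣ) : 𝒪) - 1) (g : G)
    (x : Submodule.torsionBy 𝒪 (Cofree (FramedRep.twist ρ χ) F) r) :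
    ((torsionRep (cofreeContinuousRep F (FramedRep.twist ρ χ) hF) r g x :
        Submodule.torsionBy 𝒪 (Cofree (FramedRep.twist ρ χ) F) r) : Cofree (FramedRep.twist ρ χ) F) =
      ((torsionRep (cofreeContinuousRep F ρ hF) r g
          (show Submodule.torsionBy 𝒪 (Cofree ρ F) r from x) : Submodule.torsionBy 𝒪 (Cofree ρ F) r) : Cofree ρ F) := by
  rw [torsionRep_cofree_twist_apply_coe F ρ χ hF hχ g x, torsionRep_apply_coe, cofreeContinuousRep_apply, smul_def]

/-- **Equivariant isomorphisms out of `A(ρ)[r]` are equivariant out of `A(ρ ⊗ χ)[r]` when `χ ≡ 1 (mod r)`.** In the shape of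
the member congruence (b) (`Skinner2016.HidaCongruentMember.exists_equivariant_equiv`: an `𝒪`-linear `e : A[p^m] ≃ S` onto a
submodule `S` of a `G`-module `N`, with `e(σ·a) = σ·e(a)` in `N`): the SAME `e` serves the twisted lattice. For the self-dual twist
`χ = ε^{1−k/2}` of a Hida member of weight `k ≡ 2 (mod 2(p−1)p^{m−1})` this turns the untwisted congruence
`A_{g_m}[p^m] ≅ (E[p^∞] ⊗ 𝒪)[p^m]` into the one for the erratum's self-dual `A_{g_m}` (hypothesis `hχ` from
`pow_dvd_units_map_zpow_sub_one`). [cite: Castella2018Erratum, §2 (p. 2) and proof of Thm. 1.1 (p. 4, (a)(b))]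
[cite: Skinner2016PacificMC, §2.6 (2-6-1)] -/
theorem exists_equivariant_equiv_torsion_twist (ρ : FramedRep G 𝒪 n) (χ : G →ₜ* 𝒪ˣ) (hF : HasOpenDenominators 𝒪 F)
    {r : 𝒪} (hχ : ∀ g, r ∣ ((χ g : 𝒪ˣ) : 𝒪) - 1) {N : Type*} [AddCommGroup N] [Module 𝒪 N] (S : Submodule 𝒪 N)
    (act : G → N → N)
    (h : ∃ e : Submodule.torsionBy 𝒪 (Cofree ρ F) r ≃ₗ[𝒪] S,
      ∀ (σ : G) (a : Submodule.torsionBy 𝒪 (Cofree ρ F) r),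
        (e (torsionRep (cofreeContinuousRep F ρ hF) r σ a) : N) = act σ (e a : N)) :
    ∃ e : Submodule.torsionBy 𝒪 (Cofree (FramedRep.twist ρ χ) F) r ≃ₗ[𝒪] S,
      ∀ (σ : G) (a : Submodule.torsionBy 𝒪 (Cofree (FramedRep.twist ρ χ) F) r),
        (e (torsionRep (cofreeContinuousRep F (FramedRep.twist ρ χ) hF) r σ a) : N) = act σ (e a : N) := by
  obtain ⟨e, he⟩ := h
  refine ⟨show Submodule.torsionBy 𝒪 (Cofree (FramedRep.twist ρ χ) F) r ≃ₗ[𝒪] S from e, fun σ a ↦ ?_⟩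
  have key : torsionRep (cofreeContinuousRep F (FramedRep.twist ρ χ) hF) r σ a =
      (show Submodule.torsionBy 𝒪 (Cofree (FramedRep.twist ρ χ) F) r from
        torsionRep (cofreeContinuousRep F ρ hF) r σ (show Submodule.torsionBy 𝒪 (Cofree ρ F) r from a)) :=
    Subtype.ext (torsionRep_cofree_twist_apply F ρ χ hF hχ σ a)
  rw [key]
  exact he σ (show Submodule.torsionBy 𝒪 (Cofree ρ F) r from a)

end Twist

end Literature.NumberTheory.EllipticCurves.GreenbergSelmer

end
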